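import Literature.Probability.Percolation.AnchoredIsoperimetricProfileUpperBound
import Literature.Probability.Percolation.SupercriticalIsoperimetricProfileDischarge
import HarnessLib

/-!
# The anchored isoperimetric profile above `p_c` is of order `1/n` — unconditionally

Topic `Literature/Probability/Percolation`. Theorems only. The order-of-magnitude form of

* [Dembin2020] B. Dembin, ALEA 17 (2020), Thm. 1.1 = [CerfDembin2020] R. Cerf, B. Dembin, Electron.
  Commun. Probab. 25 (2020), Thm. 1.1: for `p > p_c(ℤ^d)`, a.s. on `{0 ∈ C_∞}`, `n φ̂_n(p) → φ(p) > 0`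
  ("`φ_n n` is of order `1`", Dembin 2020 §1),

namely `liminf_n n φ̂_n(p) > 0` (all `d ≥ 2`) and `c ≤ n φ̂_n(p) ≤ C` eventually (`d ≥ 3`), now
UNCONDITIONAL: the tree's reductions `ae_mul_card_le_of_pete`,
`ae_eventually_le_mul_anchoredProfile_of_pete`, `ae_exists_mul_card_le_of_pete`
(`AnchoredIsoperimetricProfileLowerBound.lean`) and `ae_eventually_mul_anchoredProfile_mem_Icc`
(`AnchoredIsoperimetricProfileUpperBound.lean`) took Pete's Corollary 1.3 as the hypothesis
`(h : Pete2008_cor13)`; that named fact is discharged (`Pete2008_cor13_holds`,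
`SupercriticalIsoperimetricProfileDischarge.lean`), and this file records the resulting theorems.
The LIMIT statement `CerfDembin2020_thm11` (existence of `lim n φ̂_n` and its value `φ(p)`) is
Dembin's large-deviation theorem and remains a named fact.

## References

* B. Dembin, ALEA Lat. Am. J. Probab. Math. Stat. 17 (2020), Thm. 1.1 and §1 [Dembin2020].
* R. Cerf, B. Dembin, Electron. Commun. Probab. 25 (2020), Thm. 1.1 [CerfDembin2020].
* G. Pete, Electron. Commun. Probab. 13 (2008), Cor. 1.3 [Pete2008].
-/

noncomputable section

namespace Literature.Probability.Percolation

open LatticeModels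
open _root_.MeasureTheory _root_.Filter
open scoped _root_.Topology

variable {d : ℕ}

/-- **`liminf_n n φ̂_n(p) > 0` above `p_c`, competitor form, unconditionally** (Dembin 2020 Thm. 1.1,
positivity half, via Pete 2008 Cor. 1.3): for `d ≥ 2` and `p > p_c(ℤ^d)` there is `c = c(p,d) > 0`
such that `P_p`-a.s. on `{C(0) infinite}` there is `N` with `c |H| ≤ n |∂_ω H|` for all `n ≥ N` and
all valid subgraphs `H` of `C(0)` with `|H| ≤ n^d`.
[cite: Dembin2020, Thm. 1.1 and §1 (φ_n n is of order 1)] -/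
theorem ae_mul_card_le (hd : 2 ≤ d) (p : unitInterval)
    (hp : criticalProb (zdGraph d) (0 : Site d) < (p : ℝ)) :
    ∃ c : ℝ, 0 < c ∧ ∀ᵐ ω ∂(bondPercolation (zdGraph d) p), (openCluster ω 0).Infinite →
      ∃ N : ℕ, ∀ n : ℕ, N ≤ n → ∀ H : Finset (Site d),
        IsValidSubgraph d ω H → H.card ≤ n ^ d →
          c * H.card ≤ (n : ℝ) * (openEdgeBoundaryCard d ω H : ℝ) :=
  ae_mul_card_le_of_pete Pete2008_cor13_holds hd p hp

/-- **`liminf_n n φ̂_n(p) ≥ c(p,d) > 0` a.s. on `{C(0) infinite}`, profile form, unconditionally**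
(`d ≥ 2`, `p > p_c`). [cite: Dembin2020, Thm. 1.1 and §1 (φ_n n is of order 1)] -/
theorem ae_eventually_le_mul_anchoredProfile (hd : 2 ≤ d) (p : unitInterval)
    (hp : criticalProb (zdGraph d) (0 : Site d) < (p : ℝ)) :
    ∃ c : ℝ, 0 < c ∧ ∀ᵐ ω ∂(bondPercolation (zdGraph d) p), (openCluster ω 0).Infinite →
      ∀ᶠ n : ℕ in atTop, c ≤ (n : ℝ) * anchoredProfile d n ω :=
  ae_eventually_le_mul_anchoredProfile_of_pete Pete2008_cor13_holds hd p hp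

/-- **The route form, unconditionally** (`d ≥ 2`, `p > p_c`): `P_p`-a.s. on `{C(0) infinite}` there
are `c > 0` and `N` with `c |K| ≤ n |∂°K|` for all `n ≥ N` and all valid `K` with `|K| ≤ n^d` — the
conclusion `CerfDembin2020_thm11.ae_exists_mul_card_le`, now from Pete's discharged Corollary 1.3.
[cite: CerfDembin2020, Thm. 1.1 (consequence: liminf n φ̂_n > 0)] -/
theorem ae_exists_mul_card_le (hd : 2 ≤ d) (p : unitInterval)
    (hp : criticalProb (zdGraph d) (0 : Site d) < (p : ℝ)) :
    ∀ᵐ ω ∂(bondPercolation (zdGraph d) p), (openCluster ω 0).Infinite →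
      ∃ c : ℝ, 0 < c ∧ ∃ N : ℕ, ∀ n : ℕ, N ≤ n → ∀ K : Finset (Site d),
        IsValidSubgraph d ω K → K.card ≤ n ^ d →
          c * K.card ≤ (n : ℝ) * (openEdgeBoundaryCard d ω K : ℝ) :=
  ae_exists_mul_card_le_of_pete Pete2008_cor13_holds hd p hp

/-- **Cerf–Dembin / Dembin Theorem 1.1 in order of magnitude, unconditionally** (`d ≥ 3`,
`p > p_c`): there are constants `0 < c ≤ C` such that `P_p`-a.s. on `{C(0) infinite}`,
`c ≤ n φ̂_n(p) ≤ C` for all large `n`. (The limit and its value `φ(p)` — `CerfDembin2020_thm11` —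
remain Dembin's theorem, not proved here.) [cite: Dembin2020, Thm. 1.1 and §1 (φ_n n is of order 1)] -/
theorem ae_eventually_mul_anchoredProfile_mem_Icc' (hd : 3 ≤ d) (p : unitInterval)
    (hp : criticalProb (zdGraph d) (0 : Site d) < (p : ℝ)) :
    ∃ c C : ℝ, 0 < c ∧ c ≤ C ∧ ∀ᵐ ω ∂(bondPercolation (zdGraph d) p), (openCluster ω 0).Infinite →
      ∀ᶠ n : ℕ in atTop, (n : ℝ) * anchoredProfile d n ω ∈ Set.Icc c C :=
  ae_eventually_mul_anchoredProfile_mem_Icc Pete2008_cor13_holds hd p hp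

end Literature.Probability.Percolation

end
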